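import Literature.RepresentationTheory.GeneralLinear.PositionwiseWordOperators
import Mathlib.Logic.Equiv.Fin.Basic
import HarnessLib

/-!
# `𝔰𝔩₂`-invariants in one block of tensor positions: the first fundamental theorem for `SL₂` on a
# tensor factor, `(M ⊗ N)^{𝔰𝔩₂ ⊗ 1} = M^{𝔰𝔩₂} ⊗ N`, in the word model

Topic `Literature/RepresentationTheory/GeneralLinear`; infrastructure over the coordinate ("words")
model of tensor powers, continuing `PositionwiseWordOperators` (brick L2a: position-dependent actions
and differentials `wordRepAt`, `wordDerAt`) and `WordRaisingOperator` (the first fundamental theorem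
for `SL₂` in tensor form: `mem_span_polytabloid_rect_of_wordRaise_eq_zero`, Goodman–Wallach
Thm. 5.3.3 for `dim V = 2`). Brick L2b of the Literature lane's plan for Imai's theorem (cell
`pub-hodge-ring2`, literature seat gen 33): after the Lie step
(`Sl2ProductRationalSubalgebras.sl2_product_annihilator`) the rational coefficient tensor of a Hodge
class on `E₁^{n₁} × ⋯ × E_r^{n_r}` is killed by `𝔰𝔩₂` placed in the tensor positions whose slot
belongs to a curve `E_i` without complex multiplication; this file turns that annihilation into a
DECOMPOSITION — the tensor is a sum of (two-row rectangular polytabloid in the block of positions of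
colour `i`) ⊗ (basis tensor in the remaining positions). PUBLISHED STATEMENTS (the isotypic / invariant
part of a tensor product with a trivial factor is the invariant part of the first factor tensor the
second — exactness of `⊗` over a field —, and the FFT for `SL₂`), NEW FORMAL PROOFS.

## Contents (all proved; no named fact, no `sorry`)

For a splitting `φ : Fin d ≃ Fin m ⊕ Fin r` of the positions into a BLOCK (`inl`) and its complement:

* §1 words: `blockWord φ ε` / `restWord φ ε` (the two restrictions of a word), `glueWord φ ε₁ ε₂`
  (the word with prescribed restrictions) and their calculus (`Function.update` in the block);
  `glueTensor φ c₁ c₂` — the tensor `c₁ ⊗ c₂` placed along `φ`, `ε ↦ c₁(ε|block) c₂(ε|rest)`; the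
  block slices `blockSlice φ s η : Word N m → k`, `ε₁ ↦ s(glue ε₁ η)`, and the reconstruction
  `s = ∑_η glueTensor φ (blockSlice φ s η) δ_η` (`eq_sum_glueTensor_blockSlice`).
* §2 the block family `blockFamily φ A = (A on the block, 0 elsewhere)` and
  **`wordDerAt_blockFamily_glueWord`**: `(D(A ⊕ 0) s)(glue ε₁ η) = (D(A) s_η)(ε₁)` — the block
  differential acts slice by slice through the tree's one-matrix `wordDer`; hence
  `D(A ⊕ 0) s = 0 ⟺ ∀ η, D(A) s_η = 0` (`wordDer_blockSlice_eq_zero_iff`).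
* §3 (`N = 2`, `k` a field of characteristic zero, block of even size `m = 2j`)
  **`mem_span_glueTensor_polytabloid`**: if `D(E₀₁ ⊕ 0) s = 0` and `D(h ⊕ 0) s = 0`
  (`h = diag(1, −1)`; i.e. `𝔰𝔩₂` in the block kills `s`), then
  `s ∈ span_k { glueTensor φ e_T δ_η : T standard of shape (j, j), η : Word 2 r }`
  — Goodman–Wallach Thm. 5.3.3 on the block (via `mem_span_polytabloid_rect_of_wordRaise_eq_zero`:
  `h`-killed means balanced content in the block, `E₀₁`-killed means highest weight); and
  `eq_zero_of_wordDerAt_blockFamily_diag_of_odd`: a block of ODD size killed by `h ⊕ 0` carries only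
  the zero tensor.

## References

* [GoodmanWallachGTM255] R. Goodman, N. R. Wallach, *Symmetry, Representations, and Invariants*,
  GTM 255 (2009), §4.1.1 (tensor products of representations; the differential acts factor by
  factor), §5.3.2 Thm. 5.3.3 (FFT for `Sp(V)`, tensor version; `Sp₂ = SL₂`).
  [cite: GoodmanWallachGTM255, §4.1.1 and Thm. 5.3.3]
* [FultonYoungTableaux1997] W. Fulton, *Young Tableaux*, LMS Student Texts 35 (1997), §8.1 (the
  word basis `e_w` of `V^{⊗d}`; polytabloids `e_T`). [cite: FultonYoungTableaux1997, §8.1]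
-/

noncomputable section

open scoped BigOperators

namespace Literature.RepresentationTheory.GeneralLinear

open Literature.NumberTheory.DiophantineGeometry

/-! ### §1 Words split along a block of positions; glued tensors; block slices -/

section Words

variable {N d m r : ℕ} (φ : Fin d ≃ Fin m ⊕ Fin r)

/-- The restriction of a word to the block. [cite: FultonYoungTableaux1997, §8.1] -/
def blockWord (ε : Word N d) : Word N m := fun a => ε (φ.symm (Sum.inl a))

/-- The restriction of a word to the complement of the block. [cite: FultonYoungTableaux1997, §8.1] -/
def restWord (ε : Word N d) : Word N r := fun b => ε (φ.symm (Sum.inr b))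

/-- The word with prescribed restrictions to the block and to its complement.
[cite: FultonYoungTableaux1997, §8.1] -/
def glueWord (ε₁ : Word N m) (ε₂ : Word N r) : Word N d := fun p => Sum.elim ε₁ ε₂ (φ p)

/-- A glued word restricted to a block position. [cite: FultonYoungTableaux1997, §8.1] -/
@[simp]
theorem glueWord_apply_inl (ε₁ : Word N m) (ε₂ : Word N r) (a : Fin m) :
    glueWord φ ε₁ ε₂ (φ.symm (Sum.inl a)) = ε₁ a := by
  simp [glueWord]

/-- A glued word restricted to a complement position. [cite: FultonYoungTableaux1997, §8.1] -/
@[simp]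
theorem glueWord_apply_inr (ε₁ : Word N m) (ε₂ : Word N r) (b : Fin r) :
    glueWord φ ε₁ ε₂ (φ.symm (Sum.inr b)) = ε₂ b := by
  simp [glueWord]

/-- The block part of a glued word. [cite: FultonYoungTableaux1997, §8.1] -/
@[simp]
theorem blockWord_glueWord (ε₁ : Word N m) (ε₂ : Word N r) : blockWord φ (glueWord φ ε₁ ε₂) = ε₁ := by
  funext a; simp [blockWord]

/-- The complement part of a glued word. [cite: FultonYoungTableaux1997, §8.1] -/
@[simp]
theorem restWord_glueWord (ε₁ : Word N m) (ε₂ : Word N r) : restWord φ (glueWord φ ε₁ ε₂) = ε₂ := by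
  funext b; simp [restWord]

/-- A word is glued from its two restrictions. [cite: FultonYoungTableaux1997, §8.1] -/
@[simp]
theorem glueWord_blockWord_restWord (ε : Word N d) : glueWord φ (blockWord φ ε) (restWord φ ε) = ε := by
  funext p
  simp only [glueWord]
  rcases h : φ p with a | b
  · rw [Sum.elim_inl]
    change ε (φ.symm (Sum.inl a)) = ε p
    rw [← h, Equiv.symm_apply_apply]
  · rw [Sum.elim_inr]
    change ε (φ.symm (Sum.inr b)) = ε p
    rw [← h, Equiv.symm_apply_apply]

/-- Splitting a word along the block is a bijection `Word N d ≃ Word N m × Word N r`.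
[cite: FultonYoungTableaux1997, §8.1] -/
def splitWordEquiv : Word N d ≃ Word N m × Word N r where
  toFun ε := (blockWord φ ε, restWord φ ε)
  invFun x := glueWord φ x.1 x.2
  left_inv ε := glueWord_blockWord_restWord φ ε
  right_inv x := by
    obtain ⟨ε₁, ε₂⟩ := x
    simp

/-- Unfolding lemma for `splitWordEquiv`. [cite: FultonYoungTableaux1997, §8.1] -/
@[simp]
theorem splitWordEquiv_apply (ε : Word N d) : splitWordEquiv φ ε = (blockWord φ ε, restWord φ ε) := rfl

/-- Unfolding lemma for the inverse of `splitWordEquiv`. [cite: FultonYoungTableaux1997, §8.1] -/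
@[simp]
theorem splitWordEquiv_symm_apply (x : Word N m × Word N r) :
    (splitWordEquiv φ).symm x = glueWord φ x.1 x.2 := rfl

/-- Updating a glued word at a block position updates the block word. [cite: FultonYoungTableaux1997, §8.1] -/
theorem update_glueWord_inl (ε₁ : Word N m) (ε₂ : Word N r) (a : Fin m) (b : Fin N) :
    Function.update (glueWord φ ε₁ ε₂) (φ.symm (Sum.inl a)) b = glueWord φ (Function.update ε₁ a b) ε₂ := by
  funext p
  by_cases hp : p = φ.symm (Sum.inl a)
  · subst hp
    simp
  · rw [Function.update_of_ne hp]
    simp only [glueWord]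
    rcases h : φ p with a' | b'
    · have ha' : a' ≠ a := by
        rintro rfl
        exact hp (by rw [← h, Equiv.symm_apply_apply])
      simp [Function.update_of_ne ha']
    · simp

/-- Updating a glued word at a complement position updates the complement word. [cite: FultonYoungTableaux1997, §8.1] -/
theorem update_glueWord_inr (ε₁ : Word N m) (ε₂ : Word N r) (b₀ : Fin r) (b : Fin N) :
    Function.update (glueWord φ ε₁ ε₂) (φ.symm (Sum.inr b₀)) b = glueWord φ ε₁ (Function.update ε₂ b₀ b) := by
  funext p
  by_cases hp : p = φ.symm (Sum.inr b₀)
  · subst hp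
    simp
  · rw [Function.update_of_ne hp]
    simp only [glueWord]
    rcases h : φ p with a' | b'
    · simp
    · have hb' : b' ≠ b₀ := by
        rintro rfl
        exact hp (by rw [← h, Equiv.symm_apply_apply])
      simp [Function.update_of_ne hb']

/-- Sums over the positions split along the block. [folklore] -/
private theorem sum_pos_eq_sum_add_sum {M : Type*} [AddCommMonoid M] (f : Fin d → M) :
    (∑ p, f p) = (∑ a : Fin m, f (φ.symm (Sum.inl a))) + ∑ b : Fin r, f (φ.symm (Sum.inr b)) := by
  rw [← Equiv.sum_comp φ.symm, Fintype.sum_sum_type]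

/-- **Block slices**: for a word `η` on the complement, the tensor `ε₁ ↦ s(glue ε₁ η)` on the block.
[cite: FultonYoungTableaux1997, §8.1] -/
def blockSlice {k : Type*} (s : Word N d → k) (η : Word N r) : Word N m → k :=
  fun ε₁ => s (glueWord φ ε₁ η)

/-- Unfolding lemma for `blockSlice`. [cite: FultonYoungTableaux1997, §8.1] -/
theorem blockSlice_apply {k : Type*} (s : Word N d → k) (η : Word N r) (ε₁ : Word N m) :
    blockSlice φ s η ε₁ = s (glueWord φ ε₁ η) := rfl

variable {k : Type*} [CommRing k]

/-- **The tensor `c₁ ⊗ c₂` placed along the splitting `φ`**: `ε ↦ c₁(ε|block) · c₂(ε|rest)`.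
[cite: FultonYoungTableaux1997, §8.1] -/
def glueTensor (c₁ : Word N m → k) (c₂ : Word N r → k) : Word N d → k :=
  fun ε => c₁ (blockWord φ ε) * c₂ (restWord φ ε)

/-- Unfolding lemma for `glueTensor`. [cite: FultonYoungTableaux1997, §8.1] -/
theorem glueTensor_apply (c₁ : Word N m → k) (c₂ : Word N r → k) (ε : Word N d) :
    glueTensor φ c₁ c₂ ε = c₁ (blockWord φ ε) * c₂ (restWord φ ε) := rfl

/-- `(c₁ ⊗ c₂)(glue ε₁ ε₂) = c₁(ε₁) c₂(ε₂)`. [cite: FultonYoungTableaux1997, §8.1] -/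
@[simp]
theorem glueTensor_glueWord (c₁ : Word N m → k) (c₂ : Word N r → k) (ε₁ : Word N m) (ε₂ : Word N r) :
    glueTensor φ c₁ c₂ (glueWord φ ε₁ ε₂) = c₁ ε₁ * c₂ ε₂ := by
  simp [glueTensor]

/-- `glueTensor` is additive in the block factor. [cite: FultonYoungTableaux1997, §8.1] -/
theorem glueTensor_add_left (c₁ c₁' : Word N m → k) (c₂ : Word N r → k) :
    glueTensor φ (c₁ + c₁') c₂ = glueTensor φ c₁ c₂ + glueTensor φ c₁' c₂ := by
  funext ε; simp [glueTensor, add_mul]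

/-- `glueTensor` is homogeneous in the block factor. [cite: FultonYoungTableaux1997, §8.1] -/
theorem glueTensor_smul_left (t : k) (c₁ : Word N m → k) (c₂ : Word N r → k) :
    glueTensor φ (t • c₁) c₂ = t • glueTensor φ c₁ c₂ := by
  funext ε; simp [glueTensor, mul_assoc]

/-- `glueTensor (·) c₂` is linear in the block factor. [cite: FultonYoungTableaux1997, §8.1] -/
def glueTensorLeft (c₂ : Word N r → k) : (Word N m → k) →ₗ[k] (Word N d → k) where
  toFun c₁ := glueTensor φ c₁ c₂
  map_add' c₁ c₁' := glueTensor_add_left φ c₁ c₁' c₂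
  map_smul' t c₁ := glueTensor_smul_left φ t c₁ c₂

/-- Unfolding lemma for `glueTensorLeft`. [cite: FultonYoungTableaux1997, §8.1] -/
@[simp]
theorem glueTensorLeft_apply (c₂ : Word N r → k) (c₁ : Word N m → k) :
    glueTensorLeft φ c₂ c₁ = glueTensor φ c₁ c₂ := rfl

/-- **Reconstruction from block slices**: `s = ∑_η s_η ⊗ δ_η` along `φ`.
[cite: FultonYoungTableaux1997, §8.1] -/
theorem eq_sum_glueTensor_blockSlice (s : Word N d → k) :
    s = ∑ η : Word N r, glueTensor φ (blockSlice φ s η) (Pi.single η 1) := by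
  classical
  funext ε
  rw [Finset.sum_apply, Finset.sum_eq_single (restWord φ ε)]
  · rw [glueTensor_apply, blockSlice_apply, glueWord_blockWord_restWord, Pi.single_eq_same, mul_one]
  · intro η _ hη
    rw [glueTensor_apply, Pi.single_eq_of_ne (Ne.symm hη), mul_zero]
  · intro h
    exact absurd (Finset.mem_univ _) h

end Words

/-! ### §2 The block differential acts slice by slice -/

section BlockDer

variable (k : Type*) [CommRing k] {N d m r : ℕ} (φ : Fin d ≃ Fin m ⊕ Fin r)

/-- The family `A ⊕ 0`: the matrix `A` at the block positions, `0` at the others.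
[cite: GoodmanWallachGTM255, §4.1.1] -/
def blockFamily (A : Matrix (Fin N) (Fin N) k) : Fin d → Matrix (Fin N) (Fin N) k :=
  fun p => Sum.elim (fun _ => A) (fun _ => 0) (φ p)

/-- The block family at a block position is `A`. [cite: GoodmanWallachGTM255, §4.1.1] -/
@[simp]
theorem blockFamily_inl (A : Matrix (Fin N) (Fin N) k) (a : Fin m) :
    blockFamily k φ A (φ.symm (Sum.inl a)) = A := by
  simp [blockFamily]

/-- The block family at a complement position is `0`. [cite: GoodmanWallachGTM255, §4.1.1] -/
@[simp]
theorem blockFamily_inr (A : Matrix (Fin N) (Fin N) k) (b : Fin r) :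
    blockFamily k φ A (φ.symm (Sum.inr b)) = 0 := by
  simp [blockFamily]

/-- `blockFamily` is additive. [cite: GoodmanWallachGTM255, §4.1.1] -/
theorem blockFamily_add (A B : Matrix (Fin N) (Fin N) k) :
    blockFamily k φ (A + B) = blockFamily k φ A + blockFamily k φ B := by
  funext p
  simp only [blockFamily, Pi.add_apply]
  rcases φ p with a | b <;> simp

/-- `blockFamily` is multiplicative (pointwise products). [cite: GoodmanWallachGTM255, §4.1.1] -/
theorem blockFamily_mul (A B : Matrix (Fin N) (Fin N) k) :
    blockFamily k φ (A * B) = blockFamily k φ A * blockFamily k φ B := by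
  funext p
  simp only [blockFamily, Pi.mul_apply]
  rcases φ p with a | b <;> simp

/-- **The block differential acts slice by slice**: `(D(A ⊕ 0) s)(glue ε₁ η) = (D(A) s_η)(ε₁)`
(`1 ⊗ ⋯ ⊗ A ⊗ ⋯ ⊗ 1` with `A` running over the block positions only touches the block word).
[cite: GoodmanWallachGTM255, §4.1.1] -/
theorem wordDerAt_blockFamily_glueWord (A : Matrix (Fin N) (Fin N) k) (s : Word N d → k)
    (ε₁ : Word N m) (η : Word N r) :
    wordDerAt k (blockFamily k φ A) s (glueWord φ ε₁ η) = wordDer k A (blockSlice φ s η) ε₁ := by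
  rw [wordDerAt_apply, wordDer_apply, sum_pos_eq_sum_add_sum φ]
  have h2 : (∑ b : Fin r, ∑ b' : Fin N, blockFamily k φ A (φ.symm (Sum.inr b)) (glueWord φ ε₁ η (φ.symm (Sum.inr b))) b' *
      s (Function.update (glueWord φ ε₁ η) (φ.symm (Sum.inr b)) b')) = 0 := by
    refine Finset.sum_eq_zero fun b _ => Finset.sum_eq_zero fun b' _ => ?_
    rw [blockFamily_inr, Matrix.zero_apply, zero_mul]
  rw [h2, add_zero]
  refine Finset.sum_congr rfl fun a _ => Finset.sum_congr rfl fun b' _ => ?_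
  rw [blockFamily_inl, glueWord_apply_inl, update_glueWord_inl, blockSlice_apply]

/-- The block slices of the block differential are the one-matrix differentials of the block
slices. [cite: GoodmanWallachGTM255, §4.1.1] -/
theorem blockSlice_wordDerAt_blockFamily (A : Matrix (Fin N) (Fin N) k) (s : Word N d → k)
    (η : Word N r) :
    blockSlice φ (wordDerAt k (blockFamily k φ A) s) η = wordDer k A (blockSlice φ s η) := by
  funext ε₁
  rw [blockSlice_apply, wordDerAt_blockFamily_glueWord]

/-- **`D(A ⊕ 0) s = 0` iff `D(A)` kills every block slice of `s`.**
[cite: GoodmanWallachGTM255, §4.1.1] -/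
theorem wordDerAt_blockFamily_eq_zero_iff (A : Matrix (Fin N) (Fin N) k) (s : Word N d → k) :
    wordDerAt k (blockFamily k φ A) s = 0 ↔ ∀ η : Word N r, wordDer k A (blockSlice φ s η) = 0 := by
  constructor
  · intro h η
    rw [← blockSlice_wordDerAt_blockFamily, h]
    rfl
  · intro h
    funext ε
    rw [← glueWord_blockWord_restWord φ ε, wordDerAt_blockFamily_glueWord, h]
    rfl

/-- The block differential of a glued tensor: `D(A ⊕ 0)(c₁ ⊗ c₂) = (D(A) c₁) ⊗ c₂`.
[cite: GoodmanWallachGTM255, §4.1.1] -/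
theorem wordDerAt_blockFamily_glueTensor (A : Matrix (Fin N) (Fin N) k) (c₁ : Word N m → k)
    (c₂ : Word N r → k) :
    wordDerAt k (blockFamily k φ A) (glueTensor φ c₁ c₂) = glueTensor φ (wordDer k A c₁) c₂ := by
  funext ε
  rw [← glueWord_blockWord_restWord φ ε, wordDerAt_blockFamily_glueWord, glueTensor_glueWord,
    wordDer_apply, wordDer_apply, Finset.sum_mul]
  refine Finset.sum_congr rfl fun a _ => ?_
  rw [Finset.sum_mul]
  refine Finset.sum_congr rfl fun b _ => ?_
  simp only [blockSlice_apply, glueTensor_glueWord, mul_assoc]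

end BlockDer

/-! ### §3 `𝔰𝔩₂` in the block: the invariants are polytabloids in the block tensor anything -/

section Sl2Block

variable (k : Type*) [Field k] [CharZero k] {d m r : ℕ} (φ : Fin d ≃ Fin m ⊕ Fin r)

/-- A tensor on a block killed by `h = diag(1, −1)` is supported on words of balanced content.
[cite: GoodmanWallachGTM255, §2.3.1 (2.16)] -/
theorem wordContent_eq_of_wordDer_diag_eq_zero {c : Word 2 m → k}
    (hH : wordDer k (Matrix.diagonal ![(1 : k), -1]) c = 0) (w : Word 2 m) (hw : c w ≠ 0) :
    wordContent w 0 = wordContent w 1 := by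
  have h := congrFun hH w
  rw [wordDer_diagonal_apply_wordContent, Pi.zero_apply] at h
  have h' : ((wordContent w 0 : k) - wordContent w 1) * c w = 0 := by
    rw [← h]
    congr 1
    simp [Fin.sum_univ_two]
    ring
  rcases mul_eq_zero.1 h' with h0 | h0
  · exact_mod_cast sub_eq_zero.1 h0
  · exact absurd h0 hw

/-- A tensor on a block of EVEN size `2j` killed by `h` is supported on words of content `(j, j)`.
[cite: GoodmanWallachGTM255, §2.3.1 (2.16)] -/
theorem wordContent_eq_half_of_wordDer_diag_eq_zero {j : ℕ} {c : Word 2 (2 * j) → k}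
    (hH : wordDer k (Matrix.diagonal ![(1 : k), -1]) c = 0) (w : Word 2 (2 * j)) (hw : c w ≠ 0)
    (i : Fin 2) : wordContent w i = j := by
  have hbal := wordContent_eq_of_wordDer_diag_eq_zero k hH w hw
  have hsum := sum_wordContent w
  rw [Fin.sum_univ_two] at hsum
  fin_cases i
  · change wordContent w 0 = j
    omega
  · change wordContent w 1 = j
    omega

/-- A tensor on a block of ODD size killed by `h` vanishes (no balanced words).
[cite: GoodmanWallachGTM255, §2.3.1 (2.16)] -/
theorem eq_zero_of_wordDer_diag_eq_zero_of_odd (hm : Odd m) {c : Word 2 m → k}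
    (hH : wordDer k (Matrix.diagonal ![(1 : k), -1]) c = 0) : c = 0 := by
  funext w
  by_contra hw
  have hbal := wordContent_eq_of_wordDer_diag_eq_zero k hH w hw
  have hsum := sum_wordContent w
  rw [Fin.sum_univ_two, hbal] at hsum
  obtain ⟨t, ht⟩ := hm
  omega

/-- **A block of odd size killed by `h ⊕ 0` carries only the zero tensor.**
[cite: GoodmanWallachGTM255, §2.3.1 (2.16) and §4.1.1] -/
theorem eq_zero_of_wordDerAt_blockFamily_diag_of_odd (hm : Odd m) {s : Word 2 d → k}
    (hH : wordDerAt k (blockFamily k φ (Matrix.diagonal ![(1 : k), -1])) s = 0) : s = 0 := by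
  have hsl := (wordDerAt_blockFamily_eq_zero_iff k φ _ s).1 hH
  rw [eq_sum_glueTensor_blockSlice φ s]
  refine Finset.sum_eq_zero fun η _ => ?_
  rw [eq_zero_of_wordDer_diag_eq_zero_of_odd k hm (hsl η)]
  funext ε
  simp [glueTensor]

/-- **First fundamental theorem for `SL₂` on a tensor factor (block form).** Let the positions be
split as `φ : Fin d ≃ Fin 2j ⊕ Fin r` and let `s` be a tensor killed by `𝔰𝔩₂` placed in the block:
`D(E₀₁ ⊕ 0) s = 0` and `D(h ⊕ 0) s = 0`. Then `s` lies in the span of the tensors `e_T ⊗ δ_η` glued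
along `φ`, `T` a standard tableau of the two-row rectangle `(j, j)` (the block factor an
`𝔰𝔩₂`-invariant, Goodman–Wallach Thm. 5.3.3 for `dim V = 2` through
`mem_span_polytabloid_rect_of_wordRaise_eq_zero`) and `η` a word on the complement
(`(M ⊗ N)^{𝔰𝔩₂ ⊗ 1} = M^{𝔰𝔩₂} ⊗ N`). [cite: GoodmanWallachGTM255, §4.1.1 and Thm. 5.3.3] -/
theorem mem_span_glueTensor_polytabloid {j : ℕ} (φ : Fin d ≃ Fin (2 * j) ⊕ Fin r) {s : Word 2 d → k}
    (hE : wordDerAt k (blockFamily k φ (Matrix.single 0 1 (1 : k))) s = 0)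
    (hH : wordDerAt k (blockFamily k φ (Matrix.diagonal ![(1 : k), -1])) s = 0) :
    s ∈ Submodule.span k (Set.range fun Tη : StdFilling (2 * j) (twoRowRect j) × Word 2 r =>
      glueTensor φ (Tη.1.polytabloid k (twoRowRect_fst_lt j)) (Pi.single Tη.2 1)) := by
  have hEs := (wordDerAt_blockFamily_eq_zero_iff k φ _ s).1 hE
  have hHs := (wordDerAt_blockFamily_eq_zero_iff k φ _ s).1 hH
  rw [eq_sum_glueTensor_blockSlice φ s]
  refine Submodule.sum_mem _ fun η _ => ?_
  -- the block slice at `η` is a combination of rectangular polytabloids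
  have hslice : blockSlice φ s η ∈ Submodule.span k
      (Set.range fun T : StdFilling (2 * j) (twoRowRect j) => T.polytabloid k (twoRowRect_fst_lt j)) := by
    refine mem_span_polytabloid_rect_of_wordRaise_eq_zero k j ?_ ?_
    · rw [← wordDer_single]; exact hEs η
    · exact fun w hw i => wordContent_eq_half_of_wordDer_diag_eq_zero k (hHs η) w hw i
  -- push through the linear map `c₁ ↦ c₁ ⊗ δ_η`
  have hmap := Submodule.mem_map_of_mem (f := glueTensorLeft φ (Pi.single η (1 : k))) hslice
  rw [Submodule.map_span] at hmap
  rw [← glueTensorLeft_apply]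
  refine Submodule.span_mono ?_ hmap
  rintro _ ⟨_, ⟨T, rfl⟩, rfl⟩
  exact ⟨(T, η), rfl⟩

end Sl2Block

/-! ### §4 Position-dependent block families and the relative decomposition `(M ⊗ N)^{𝔤 ⊗ 1} = M^{𝔤} ⊗ N` -/

section BlockDerAt

variable (k : Type*) [CommRing k] {N d m r : ℕ} (φ : Fin d ≃ Fin m ⊕ Fin r)

/-- The family `A ⊕ 0` for a POSITION-DEPENDENT family `A` of matrices on the block: `A a` at the
block position `a`, `0` on the complement (several colours inside one block, e.g. the non-CM colours
of a mixed product of elliptic curves). [cite: GoodmanWallachGTM255, §4.1.1] -/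
def blockFamilyAt (A : Fin m → Matrix (Fin N) (Fin N) k) : Fin d → Matrix (Fin N) (Fin N) k :=
  fun p => Sum.elim A (fun _ => 0) (φ p)

/-- The position-dependent block family at a block position. [cite: GoodmanWallachGTM255, §4.1.1] -/
@[simp]
theorem blockFamilyAt_inl (A : Fin m → Matrix (Fin N) (Fin N) k) (a : Fin m) :
    blockFamilyAt k φ A (φ.symm (Sum.inl a)) = A a := by
  simp [blockFamilyAt]

/-- The position-dependent block family at a complement position is `0`. [cite: GoodmanWallachGTM255, §4.1.1] -/
@[simp]
theorem blockFamilyAt_inr (A : Fin m → Matrix (Fin N) (Fin N) k) (b : Fin r) :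
    blockFamilyAt k φ A (φ.symm (Sum.inr b)) = 0 := by
  simp [blockFamilyAt]

/-- A constant position-dependent block family is the block family `blockFamily`.
[cite: GoodmanWallachGTM255, §4.1.1] -/
theorem blockFamilyAt_const (A : Matrix (Fin N) (Fin N) k) :
    blockFamilyAt k φ (fun _ : Fin m => A) = blockFamily k φ A :=
  rfl

/-- **The position-dependent block differential acts slice by slice**:
`(D(A ⊕ 0) s)(glue ε₁ η) = (D(A) s_η)(ε₁)` with the tree's position-dependent `wordDerAt` on the block.
[cite: GoodmanWallachGTM255, §4.1.1] -/
theorem wordDerAt_blockFamilyAt_glueWord (A : Fin m → Matrix (Fin N) (Fin N) k) (s : Word N d → k)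
    (ε₁ : Word N m) (η : Word N r) :
    wordDerAt k (blockFamilyAt k φ A) s (glueWord φ ε₁ η) = wordDerAt k A (blockSlice φ s η) ε₁ := by
  rw [wordDerAt_apply, wordDerAt_apply, sum_pos_eq_sum_add_sum φ]
  have h2 : (∑ b : Fin r, ∑ b' : Fin N, blockFamilyAt k φ A (φ.symm (Sum.inr b))
      (glueWord φ ε₁ η (φ.symm (Sum.inr b))) b' *
        s (Function.update (glueWord φ ε₁ η) (φ.symm (Sum.inr b)) b')) = 0 := by
    refine Finset.sum_eq_zero fun b _ => Finset.sum_eq_zero fun b' _ => ?_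
    rw [blockFamilyAt_inr, Matrix.zero_apply, zero_mul]
  rw [h2, add_zero]
  refine Finset.sum_congr rfl fun a _ => Finset.sum_congr rfl fun b' _ => ?_
  rw [blockFamilyAt_inl, glueWord_apply_inl, update_glueWord_inl, blockSlice_apply]

/-- **`D(A ⊕ 0) s = 0` iff the position-dependent `D(A)` kills every block slice of `s`.**
[cite: GoodmanWallachGTM255, §4.1.1] -/
theorem wordDerAt_blockFamilyAt_eq_zero_iff (A : Fin m → Matrix (Fin N) (Fin N) k) (s : Word N d → k) :
    wordDerAt k (blockFamilyAt k φ A) s = 0 ↔ ∀ η : Word N r, wordDerAt k A (blockSlice φ s η) = 0 := by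
  constructor
  · intro h η
    funext ε₁
    rw [← wordDerAt_blockFamilyAt_glueWord, h]
    rfl
  · intro h
    funext ε
    rw [← glueWord_blockWord_restWord φ ε, wordDerAt_blockFamilyAt_glueWord, h]
    rfl

/-- **The relative decomposition `(M ⊗ N)^{𝔤 ⊗ 1} = M^{𝔤} ⊗ N` in the word model.** If a family of
position-dependent operators on the block, lifted to all positions as `A_j ⊕ 0`, kills `s`, then `s` is a
combination of glued tensors `u ⊗ δ_η` with `u` in the JOINT KERNEL of the `D(A_j)` on the block (the
invariants of the block Lie algebra tensor an arbitrary basis tensor of the complement) — the shape in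
which bricks L2b/L3 are consumed when only SOME colours act by `𝔰𝔩₂` (mixed products of elliptic
curves with and without complex multiplication). [cite: GoodmanWallachGTM255, §4.1.1 and Thm. 5.3.3] -/
theorem mem_span_glueTensor_of_blockFamilyAt_eq_zero {J : Type*} (A : J → Fin m → Matrix (Fin N) (Fin N) k)
    {s : Word N d → k} (h : ∀ j, wordDerAt k (blockFamilyAt k φ (A j)) s = 0) :
    s ∈ Submodule.span k {t | ∃ (u : Word N m → k) (η : Word N r),
      (∀ j, wordDerAt k (A j) u = 0) ∧ t = glueTensor φ u (Pi.single η 1)} := by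
  classical
  rw [eq_sum_glueTensor_blockSlice φ s]
  refine Submodule.sum_mem _ fun η _ => Submodule.subset_span ⟨blockSlice φ s η, η, fun j => ?_, rfl⟩
  exact (wordDerAt_blockFamilyAt_eq_zero_iff k φ (A j) s).1 (h j) η

end BlockDerAt

end Literature.RepresentationTheory.GeneralLinear
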